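import Mathlib
import Literature.Computability.AlgebraicComplexity.ASSS16BaseLevel
import Literature.Computability.AlgebraicComplexity.ASSS16GcdTrickFormulas
import Literature.Computability.AlgebraicComplexity.ASSS16LevelRecursion
import HarnessLib

/-!
# [ASSS16] §4, the base of the level recursion ONE LEVEL HIGHER: a Vandermonde block ⊕ the
# sparse-hitting `Φ` is faithful to every small family of derivatives of DEPTH-3 sub-formulas
# (gates over the sparse leaves) — proofs only (val-lit p2 g9; FSV Thm. 48, general top fan-in)

Agrawal–Saha–Saptharishi–Saxena, *Jacobian hits circuits* [AgrawalEtAl2011] (arXiv:1111.0582),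
§4, proof of Thm. `thm:dDkrPIT`, bottom of the recursion (locator paper:arxiv-1111.0582
p0010.txt:L44–L58): "each `T_i` is a sparse polynomial … any `|𝒰'| × |𝒰'|` minor of `𝒥_x(𝒰')` is
a sparse polynomial with sparsity bounded by `s^R` … one of the maps `Φ_p` … preserves the rank".
In the printed depth convention the bottom family `𝒞_{D-2}` consists of derivatives of the
products-of-sparse-polynomials gates, and the sparsity of its Jacobian minors is controlled through
Lemma 4.1 (the gcd trick, `lem:derivative-content`, p0009:L84–L97): the factors of a `×∧` gate not
involving the differentiated variables come out as a common row factor `V_G`, and what is left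
involves at most `k·|var|` sparse factors.

The tree's base (`ASSS16.baseLevel`, val-lit t21, `AC/ASSS16BaseLevel.lean`) is stated one level
LOWER, for families of derivatives of the leaves themselves (depth `≤ 2`); the landed keystone
`FSV2018_thm48_topFanIn_holds` therefore spends all `D - 2` Vandermonde blocks of FSV's layout
[ForbesShpilkaVolk2018, Thm. 48 = ToC Thm. 5.24] on the bounded-top-fan-in class. This file proves
the base AT DEPTH 3 (`ASSS16.baseLevelDepthThree`), with the sparsity bookkeeping made explicit:

* `ASSS16.exists_iterPderiv_prod_pow_eq_mul` — `Δ_γ ∏_j p_j^{e_j} = (∏_j p_j^{e_j ∸ (c+1)}) · Q` with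
  `#supp Q ≤ (q+1)^{c+1} · s^{2q(c+1)}` for `q` factors with `≤ s` monomials each and `|γ| ≤ c+1`
  (one derivative at a time: `∂_x (∏ p_j^{a_j} · Q) = ∏ p_j^{a_j ∸ 1} · Q'`,
  `#supp Q' ≤ (q+1)·s^q·#supp Q`);
* `ASSS16.exists_rowFactor_depthThree` — one row of a Jacobian minor of derivatives of a depth-`≤ 3`
  occur-`k` size-`≤ s` formula: `∂_{x_v} Δ_T G = (∏ q_j^{a_j}) · row_v` with `s`-sparse `q_j` (the
  children, Lemma 4.1) and `#supp row_v ≤ (k(c+ρ)+1)^{c+1} · s^{2k(c+ρ)(c+1)}`;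
* `ASSS16.bind₁_det_jacobian_depthThree_ne_zero` — hence `Φ` keeps every non-zero such minor non-zero
  as soon as it hits sparsity `≤ r! · ((k(c+r)+1)^{c+1} s^{2k(c+r)(c+1)})^r`;
* `ASSS16.baseLevelDepthThree` — Lemma 2.2 / Cor. 4.3 (`ASSS16.descentFaithful`) then gives the
  faithfulness of `Vdm_r ⊕ Φ` in Thm. 2.1 form, i.e. exactly the `IH` shape consumed by the tree's
  `thm48_levelInvariant_step` at `d - 1 = 3`.

With the base at depth 3 the bounded-fan-in recursion needs only `D - 3` blocks, which frees one
block of FSV's layout for the first-order extraction of `AC/FSV18VandermondeExtraction.lean`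
(consumer: `AC/FSV18Thm48Holds.lean`, the general-top-fan-in `FSV2018_thm48`).

Theorem-only; no definitions, no named facts. Honest framing: a printed PIT argument of [ASSS16]
re-based by one level with explicit sparsity constants; `VP ≠ VNP` is NOT proved and nothing here is
progress on it.

## References
* [AgrawalEtAl2011] M. Agrawal, C. Saha, R. Saptharishi, N. Saxena, *Jacobian hits circuits*,
  arXiv:1111.0582 (STOC 2012 / SICOMP 45 (2016)), §4: Lemma 4.1 (gcd trick), Lemma 4.2, Cor. 4.3,
  proof of Thm. dDkrPIT (bottom level); §2 Fact 1, Thm. 2.1, Lemma 2.2. Locators: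
  paper:arxiv-1111.0582 p0009.txt:L84–L97, p0010.txt:L44–L58, p0018.txt:L39–L62.
* [ForbesShpilkaVolk2018] M. A. Forbes, A. Shpilka, B. L. Volk, *Succinct hitting sets and barriers to
  proving lower bounds for algebraic circuits*, ToC 14 (2018): Def. 45 (seq.) = ToC Def. 5.21 (the
  formula model and its size), Thm. 48 (seq.) = ToC Thm. 5.24 (`R!·s^R`, the `D-2` blocks).
-/

noncomputable section

namespace Literature.Computability.AlgebraicComplexity

open MvPolynomial Finset Literature.Barriers.ValiantsHypothesis

open scoped BigOperators

open Literature.RepresentationTheory.AlgebraicGroups (iterPderiv iterPderiv_single iterPderiv_zero)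

namespace ASSS16

variable {F : Type*} [Field F] {ι : Type*}

/-! ### Sparsity bookkeeping (monomial counts of products, powers, sums, derivatives) -/

/-- Monomial count of a product. [folklore] -/
private theorem card_support_mul_le' (p q : MvPolynomial ι F) :
    (p * q).support.card ≤ p.support.card * q.support.card := by
  classical
  exact (Finset.card_le_card (support_mul p q)).trans Finset.card_add_le

/-- Monomial count of `1`. [folklore] -/
private theorem card_support_one_le' : (1 : MvPolynomial ι F).support.card ≤ 1 := by
  classical
  exact (Finset.card_le_card (support_monomial_subset (s := (0 : ι →₀ ℕ)) (a := (1 : F)))).trans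
    (by simp)

/-- Monomial count of a power. [folklore] -/
private theorem card_support_pow_le' (p : MvPolynomial ι F) {s : ℕ} (hp : p.support.card ≤ s) :
    ∀ a : ℕ, (p ^ a).support.card ≤ s ^ a
  | 0 => by rw [pow_zero, pow_zero]; exact card_support_one_le'
  | a + 1 => by
    rw [pow_succ, pow_succ]
    exact (card_support_mul_le' _ _).trans (Nat.mul_le_mul (card_support_pow_le' p hp a) hp)

/-- Monomial count of a finite product of polynomials with at most `s ≥ 1`-sparse powers: if every
factor has at most `s^{a_j}` monomials then the product has at most `s^{Σ a_j}`. Stated in the crude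
form used below: `≤ s` monomials per factor (exponents `≤ 1`) gives `≤ s^{|J|}`. [folklore] -/
private theorem card_support_prod_le' {α : Type*} (J : Finset α) (f : α → MvPolynomial ι F) {s : ℕ}
    (hf : ∀ a ∈ J, (f a).support.card ≤ s) :
    (∏ a ∈ J, f a).support.card ≤ s ^ J.card := by
  classical
  induction J using Finset.induction_on with
  | empty => rw [Finset.prod_empty, Finset.card_empty, pow_zero]; exact card_support_one_le'
  | insert a J ha ih =>
    rw [Finset.prod_insert ha, Finset.card_insert_of_notMem ha, pow_succ, mul_comm (s ^ _)]
    exact (card_support_mul_le' _ _).trans (Nat.mul_le_mul (hf a (Finset.mem_insert_self _ _))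
      (ih fun b hb => hf b (Finset.mem_insert_of_mem hb)))

/-- Monomial count of a finite sum. [folklore] -/
private theorem card_support_sum_le' {α : Type*} (J : Finset α) (f : α → MvPolynomial ι F) :
    (∑ a ∈ J, f a).support.card ≤ ∑ a ∈ J, (f a).support.card := by
  classical
  exact (Finset.card_le_card support_sum).trans Finset.card_biUnion_le

/-- Monomial count of a scalar multiple. [folklore] -/
private theorem card_support_C_mul_le' (c : F) (p : MvPolynomial ι F) :
    (C c * p).support.card ≤ p.support.card := by
  classical
  rw [C_mul']
  exact Finset.card_le_card support_smul

/-- Monomial count of a partial derivative. [folklore] -/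
private theorem card_support_pderiv_le' [DecidableEq ι] (x : ι) (p : MvPolynomial ι F) :
    (pderiv x p).support.card ≤ p.support.card := by
  have h : pderiv x p = iterPderiv (A := F) (Finsupp.single x 1) p := by
    rw [iterPderiv_single]; rfl
  rw [h]
  exact card_support_iterPderiv_le _ _

/-- A power `p^{min a 1}` of an `s`-sparse polynomial (`s ≥ 1`) is `s`-sparse. [folklore] -/
private theorem card_support_pow_min_le' (p : MvPolynomial ι F) {s : ℕ} (hs : 1 ≤ s)
    (hp : p.support.card ≤ s) (a : ℕ) : (p ^ min a 1).support.card ≤ s := by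
  rcases Nat.eq_zero_or_pos a with rfl | ha
  · rw [Nat.zero_min, pow_zero]; exact card_support_one_le'.trans hs
  · rw [min_eq_right ha, pow_one]; exact hp

/-! ### The second factoring: derivatives of a power product of sparse polynomials
("`Δ_{S_i} G'` is a polynomial in the children of `G'` and their derivatives", with the powers
`p_j^{e_j - (c+1)}` taken out as well, and the monomials of what is left COUNTED) -/

/-- **One derivative:** `∂_x (∏_{j ∈ J} p_j^{a_j} · Q) = (∏_{j ∈ J} p_j^{a_j ∸ 1}) · Q'` with
`#supp Q' ≤ (|J|+1) · s^{|J|} · #supp Q` when every `p_j` has at most `s ≥ 1` monomials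
(`Q' = Σ_j a_j ∂_x p_j ∏_{j' ≠ j} p_{j'}^{min(a_{j'},1)} Q + ∏_j p_j^{min(a_j,1)} ∂_x Q`).
[cite: AgrawalEtAl2011, Lemma 4.2 (= lem:descent-jacobian), proof ("a polynomial in the children … and their derivatives")]
locator: paper:arxiv-1111.0582 p0018.txt:L72–L85 -/
theorem exists_pderiv_prod_pow_mul_eq [DecidableEq ι] {α : Type*} [DecidableEq α]
    (p : α → MvPolynomial ι F) (a : α → ℕ) {s : ℕ} (hs : 1 ≤ s)
    (hp : ∀ j, (p j).support.card ≤ s) (x : ι) (J : Finset α) :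
    ∀ Q : MvPolynomial ι F, ∃ Q' : MvPolynomial ι F,
      pderiv x ((∏ j ∈ J, p j ^ a j) * Q) = (∏ j ∈ J, p j ^ (a j - 1)) * Q' ∧
        Q'.support.card ≤ (J.card + 1) * s ^ J.card * Q.support.card := by
  classical
  induction J using Finset.induction_on with
  | empty =>
    intro Q
    refine ⟨pderiv x Q, by simp, ?_⟩
    rw [Finset.card_empty, pow_zero, zero_add, one_mul, one_mul]
    exact card_support_pderiv_le' x Q
  | insert j J hj ih =>
    intro Q
    -- `∏_{insert j J} p^a · Q = p_j^{a_j} · W`, `W = ∏_J p^a · Q = ∏_J p^{a∸1} · (∏_J p^{min(a,1)} · Q)`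
    obtain ⟨Q₁, hQ₁, hQ₁c⟩ := ih Q
    have hsplit : ∀ i, p i ^ a i = p i ^ (a i - 1) * p i ^ min (a i) 1 := by
      intro i
      rw [← pow_add]
      congr 1
      rcases Nat.eq_zero_or_pos (a i) with h | h
      · rw [h]; rfl
      · rw [min_eq_right h]; omega
    have hW : (∏ i ∈ J, p i ^ a i) * Q =
        (∏ i ∈ J, p i ^ (a i - 1)) * ((∏ i ∈ J, p i ^ min (a i) 1) * Q) := by
      rw [← mul_assoc, ← Finset.prod_mul_distrib]
      exact congrArg (· * Q) (Finset.prod_congr rfl fun i _ => hsplit i)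
    refine ⟨C (a j : F) * pderiv x (p j) * ((∏ i ∈ J, p i ^ min (a i) 1) * Q) +
      p j ^ min (a j) 1 * Q₁, ?_, ?_⟩
    · rw [Finset.prod_insert hj, Finset.prod_insert hj, mul_assoc, Derivation.leibniz, hQ₁,
        Derivation.leibniz_pow, smul_eq_mul, smul_eq_mul, hW]
      simp only [nsmul_eq_mul]
      rw [hsplit j, ← map_natCast (C : F →+* MvPolynomial ι F) (a j)]
      ring
    · -- the count
      have hprodmin : (∏ i ∈ J, p i ^ min (a i) 1).support.card ≤ s ^ J.card :=
        card_support_prod_le' J _ fun i _ => card_support_pow_min_le' (p i) hs (hp i) (a i)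
      have h1 : (C (a j : F) * pderiv x (p j) * ((∏ i ∈ J, p i ^ min (a i) 1) * Q)).support.card ≤
          s * (s ^ J.card * Q.support.card) := by
        rw [mul_assoc]
        refine (card_support_C_mul_le' _ _).trans ((card_support_mul_le' _ _).trans ?_)
        exact Nat.mul_le_mul ((card_support_pderiv_le' x (p j)).trans (hp j))
          ((card_support_mul_le' _ _).trans (Nat.mul_le_mul_right _ hprodmin))
      have h2 : (p j ^ min (a j) 1 * Q₁).support.card ≤
          s * ((J.card + 1) * s ^ J.card * Q.support.card) :=
        (card_support_mul_le' _ _).trans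
          (Nat.mul_le_mul (card_support_pow_min_le' (p j) hs (hp j) (a j)) hQ₁c)
      rw [Finset.card_insert_of_notMem hj]
      calc (C (a j : F) * pderiv x (p j) * ((∏ i ∈ J, p i ^ min (a i) 1) * Q) +
            p j ^ min (a j) 1 * Q₁).support.card
          ≤ s * (s ^ J.card * Q.support.card) + s * ((J.card + 1) * s ^ J.card * Q.support.card) :=
            (Finset.card_le_card (support_add)).trans ((Finset.card_union_le _ _).trans (add_le_add h1 h2))
        _ = (J.card + 1 + 1) * s ^ (J.card + 1) * Q.support.card := by ring

/-- **All `|γ|` derivatives:** `Δ_γ ∏_{j ∈ J} p_j^{a_j} = (∏_{j ∈ J} p_j^{a_j ∸ |γ|}) · Q_γ` with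
`#supp Q_γ ≤ ((|J|+1) s^{|J|})^{|γ|}`.
[cite: AgrawalEtAl2011, Lemma 4.2 (= lem:descent-jacobian), proof ("derivatives (of order between one and `c_ℓ+1`)")]
locator: paper:arxiv-1111.0582 p0018.txt:L72–L85 -/
theorem exists_iterPderiv_prod_pow_eq_mul_degree [DecidableEq ι] {α : Type*} [DecidableEq α]
    (p : α → MvPolynomial ι F) (a : α → ℕ) {s : ℕ} (hs : 1 ≤ s)
    (hp : ∀ j, (p j).support.card ≤ s) (J : Finset α) (γ : ι →₀ ℕ) :
    ∃ Q : MvPolynomial ι F,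
      iterPderiv (A := F) γ (∏ j ∈ J, p j ^ a j) = (∏ j ∈ J, p j ^ (a j - γ.degree)) * Q ∧
        Q.support.card ≤ ((J.card + 1) * s ^ J.card) ^ γ.degree := by
  classical
  induction γ using finsupp_single_one_induction with
  | h0 =>
    refine ⟨1, ?_, ?_⟩
    · simp only [iterPderiv_zero, LinearMap.id_apply, mul_one, map_zero, Nat.sub_zero]
    · rw [map_zero, pow_zero]
      exact card_support_one_le'
  | hstep x γ ih =>
    obtain ⟨Q, hQ, hQc⟩ := ih
    obtain ⟨Q', hQ', hQ'c⟩ :=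
      exists_pderiv_prod_pow_mul_eq p (fun j => a j - γ.degree) hs hp x J Q
    refine ⟨Q', ?_, ?_⟩
    · rw [iterPderiv_single_add_apply, hQ, hQ', degree_single_add]
      refine congrArg (· * Q') (Finset.prod_congr rfl fun j _ => ?_)
      rw [Nat.sub_sub]
    · rw [degree_single_add, pow_succ]
      calc Q'.support.card ≤ (J.card + 1) * s ^ J.card * Q.support.card := hQ'c
        _ ≤ (J.card + 1) * s ^ J.card * ((J.card + 1) * s ^ J.card) ^ γ.degree :=
            Nat.mul_le_mul_left _ hQc
        _ = ((J.card + 1) * s ^ J.card) ^ γ.degree * ((J.card + 1) * s ^ J.card) := by ring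

/-- **Uniform exponents:** for `|γ| ≤ c+1` and `|J| ≤ q`,
`Δ_γ ∏_{j ∈ J} p_j^{a_j} = (∏_{j ∈ J} p_j^{a_j ∸ (c+1)}) · Q` with
`#supp Q ≤ (q+1)^{c+1} · s^{2q(c+1)}` — a factor INDEPENDENT of `γ` (the same for every entry of one
row of the Jacobian minor) times a polynomial with a controlled number of monomials.
[cite: AgrawalEtAl2011, Lemma 4.2 (= lem:descent-jacobian), proof, with §4 Thm. dDkrPIT proof ("sparsity bounded by `s^R`")]
locator: paper:arxiv-1111.0582 p0018.txt:L72–L85; p0010.txt:L52–L55 -/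
theorem exists_iterPderiv_prod_pow_eq_mul [DecidableEq ι] {α : Type*} [DecidableEq α]
    (p : α → MvPolynomial ι F) (a : α → ℕ) {s q c : ℕ} (hs : 1 ≤ s)
    (hp : ∀ j, (p j).support.card ≤ s) (J : Finset α) (hJ : J.card ≤ q) (γ : ι →₀ ℕ)
    (hγ : γ.degree ≤ c + 1) :
    ∃ Q : MvPolynomial ι F,
      iterPderiv (A := F) γ (∏ j ∈ J, p j ^ a j) = (∏ j ∈ J, p j ^ (a j - (c + 1))) * Q ∧
        Q.support.card ≤ (q + 1) ^ (c + 1) * s ^ (2 * q * (c + 1)) := by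
  classical
  obtain ⟨Q, hQ, hQc⟩ := exists_iterPderiv_prod_pow_eq_mul_degree p a hs hp J γ
  -- pad: `p^{a ∸ |γ|} = p^{a ∸ (c+1)} · p^{(a ∸ |γ|) - (a ∸ (c+1))}`, the second exponent `≤ c+1`
  refine ⟨(∏ j ∈ J, p j ^ (a j - γ.degree - (a j - (c + 1)))) * Q, ?_, ?_⟩
  · rw [hQ, ← mul_assoc, ← Finset.prod_mul_distrib]
    refine congrArg (· * Q) (Finset.prod_congr rfl fun j _ => ?_)
    rw [← pow_add]
    congr 1
    omega
  · have hpad : (∏ j ∈ J, p j ^ (a j - γ.degree - (a j - (c + 1)))).support.card ≤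
        (s ^ (c + 1)) ^ J.card := by
      refine card_support_prod_le' J _ fun j _ => ?_
      refine (card_support_pow_le' (p j) (hp j) _).trans (Nat.pow_le_pow_right hs ?_)
      omega
    have hK1 : 1 ≤ (J.card + 1) * s ^ J.card := Nat.mul_pos (Nat.succ_pos _) (Nat.pow_pos hs)
    calc ((∏ j ∈ J, p j ^ (a j - γ.degree - (a j - (c + 1)))) * Q).support.card
        ≤ (s ^ (c + 1)) ^ J.card * ((J.card + 1) * s ^ J.card) ^ γ.degree :=
          (card_support_mul_le' _ _).trans (Nat.mul_le_mul hpad hQc)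
      _ ≤ (s ^ (c + 1)) ^ q * ((q + 1) * s ^ q) ^ (c + 1) := by
          refine Nat.mul_le_mul (Nat.pow_le_pow_right (Nat.pow_pos hs) hJ) ?_
          exact (Nat.pow_le_pow_right hK1 hγ).trans (Nat.pow_le_pow_left
            (Nat.mul_le_mul (Nat.succ_le_succ hJ) (Nat.pow_le_pow_right hs hJ)) _)
      _ = (q + 1) ^ (c + 1) * s ^ (2 * q * (c + 1)) := by
          have h1 : (s ^ (c + 1)) ^ q * ((q + 1) * s ^ q) ^ (c + 1) =
              (q + 1) ^ (c + 1) * (s ^ ((c + 1) * q) * s ^ (q * (c + 1))) := by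
            rw [mul_pow, ← pow_mul, ← pow_mul]; ring
          rw [h1, ← pow_add]
          congr 2
          ring

/-! ### The `+` gates of depth `3` compute sparse polynomials (FSV's size counts the monomials) -/

/-- A `+` gate over depth-`≤ 2` arguments (leaves and constant gates) computes `constant + P` with
`#supp P ≤` the total size of the arguments. [cite: ForbesShpilkaVolk2018, Def. 45 (seq.) = ToC Def. 5.21 (size of a leaf / of a `+` gate)]
locator: paper:arxiv-1701.05328 p0020.txt:L65 -/
theorem OccurArgs.exists_evalSum_eq_C_add_of_depth_le_two :
    ∀ as : OccurArgs F ι, as.depth ≤ 2 →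
      ∃ (c₀ : F) (P : MvPolynomial ι F), as.evalSum = C c₀ + P ∧ P.support.card ≤ as.size
  | .nil => fun _ => ⟨0, 0, by rw [OccurArgs.evalSum, C_0, add_zero], by simp⟩
  | .cons φ as' => fun h => by
    classical
    rw [OccurArgs.depth] at h
    obtain ⟨c₁, P₁, hP₁, hP₁c⟩ :=
      OccurArgs.exists_evalSum_eq_C_add_of_depth_le_two as' ((le_max_right _ _).trans h)
    rcases OccurFormula.leaf_or_exists_eval_eq_C_of_depth_le_two φ ((le_max_left _ _).trans h)
      with ⟨p, rfl⟩ | ⟨c, hc⟩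
    · refine ⟨c₁, p + P₁, ?_, ?_⟩
      · rw [OccurArgs.evalSum, OccurFormula.eval, hP₁]; ring
      · rw [OccurArgs.size, OccurFormula.size]
        exact (Finset.card_le_card support_add).trans ((Finset.card_union_le _ _).trans
          (add_le_add (card_support_le_leafSize p) hP₁c))
    · refine ⟨c + c₁, P₁, ?_, ?_⟩
      · rw [OccurArgs.evalSum, hc, hP₁, C_add]; ring
      · rw [OccurArgs.size]; omega

/-- **A `+` gate of depth `≤ 3` computes a polynomial with at most size-many monomials.**
[cite: ForbesShpilkaVolk2018, Def. 45 (seq.) = ToC Def. 5.21 (size); AgrawalEtAl2011, §4 (Thm. dDkrPIT proof: "sparse polynomials")]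
locator: paper:arxiv-1701.05328 p0020.txt:L65; paper:arxiv-1111.0582 p0010.txt:L44–L46 -/
theorem card_support_eval_add_le_size_of_depth_le_three (as : OccurArgs F ι)
    (h : (OccurFormula.add as).depth ≤ 3) :
    (OccurFormula.add as).eval.support.card ≤ (OccurFormula.add as).size := by
  classical
  rw [OccurFormula.depth] at h
  obtain ⟨c₀, P, hP, hPc⟩ := OccurArgs.exists_evalSum_eq_C_add_of_depth_le_two as (by omega)
  rw [OccurFormula.eval, OccurFormula.size, hP]
  refine (Finset.card_le_card support_add).trans ((Finset.card_union_le _ _).trans ?_)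
  refine add_le_add ?_ hPc
  exact (Finset.card_le_card (support_monomial_subset (s := (0 : ι →₀ ℕ)) (a := c₀))).trans
    (by simp)

/-! ### One row of the minor: Lemma 4.1 (gcd trick) + the second factoring, with the count -/

/-- **One row of a Jacobian minor of derivatives of a depth-`≤ 3` gate, factored with explicit
sparsity.** Let `G` be a sub-formula of depth `≤ 3` (a leaf, a `+` gate over leaves, or a `×∧` gate
over leaves) with occur `≤ k` (`k ≥ 1`) and size `≤ s` (`s ≥ 1`), `T` a multiset of order `≤ c`,
`x_1, …, x_ρ` the column variables, and `k(c+ρ) ≤ q₀`. Then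
`∂_{x_v} Δ_T G = (∏_j q_j^{a_j}) · row_v` for all `v`, where the `q_j` (the children of `G`; none for
a leaf or a `+` gate) have at most `s` monomials each, and `#supp row_v ≤ (q₀+1)^{c+1}·s^{2q₀(c+1)}`.
(Lemma 4.1 takes out `V_G = ∏_{children free of var(T) ∪ {x_v}} q_j^{e_j}`; at most `k(c+ρ)` children
remain; their powers beyond `c+1` are taken out too, `exists_iterPderiv_prod_pow_eq_mul`.)
[cite: AgrawalEtAl2011, Lemma 4.1 (= lem:derivative-content) and Lemma 4.2 proof; ForbesShpilkaVolk2018, Def. 45 (seq.) = ToC Def. 5.21]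
locator: paper:arxiv-1111.0582 p0009.txt:L84–L97; p0018.txt:L58–L85 -/
theorem exists_rowFactor_depthThree [DecidableEq ι] {k s c ρ q₀ : ℕ} (hk : 1 ≤ k) (hs : 1 ≤ s)
    (G : OccurFormula F ι) (hocc : ∀ i, G.occur i ≤ k) (hsize : G.size ≤ s) (hdepth : G.depth ≤ 3)
    (T : ι →₀ ℕ) (hT : T.degree ≤ c) (x : Fin ρ → ι) (hq₀ : k * (c + ρ) ≤ q₀) :
    ∃ (ν : ℕ) (qf : Fin ν → MvPolynomial ι F) (a : Fin ν → ℕ) (row : Fin ρ → MvPolynomial ι F),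
      (∀ j, (qf j).support.card ≤ s) ∧
      (∀ v, pderiv (x v) (iterPderiv (A := F) T G.eval) = (∏ j, qf j ^ a j) * row v) ∧
      ∀ v, (row v).support.card ≤ (q₀ + 1) ^ (c + 1) * s ^ (2 * q₀ * (c + 1)) := by
  classical
  -- the target bound dominates `s` as soon as there is a column at all
  have hbig : ∀ v : Fin ρ, s ≤ (q₀ + 1) ^ (c + 1) * s ^ (2 * q₀ * (c + 1)) := by
    intro v
    have hρ : 1 ≤ ρ := Nat.one_le_iff_ne_zero.mpr (fun h => by subst h; exact v.elim0)
    have hq : 1 ≤ q₀ := le_trans (by nlinarith) hq₀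
    calc s = 1 * s ^ 1 := by ring
      _ ≤ (q₀ + 1) ^ (c + 1) * s ^ (2 * q₀ * (c + 1)) :=
        Nat.mul_le_mul (Nat.one_le_pow _ _ (Nat.succ_pos _))
          (Nat.pow_le_pow_right hs (by nlinarith))
  cases G with
  | leaf p =>
    refine ⟨0, Fin.elim0, Fin.elim0, fun v => pderiv (x v) (iterPderiv (A := F) T p),
      fun j => j.elim0, fun v => by simp [OccurFormula.eval], fun v => ?_⟩
    dsimp only
    rw [pderiv_iterPderiv]
    refine (card_support_iterPderiv_le _ _).trans (le_trans ?_ (hbig v))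
    rw [OccurFormula.size] at hsize
    exact (card_support_le_leafSize p).trans hsize
  | add as =>
    refine ⟨0, Fin.elim0, Fin.elim0,
      fun v => pderiv (x v) (iterPderiv (A := F) T (OccurFormula.add as).eval),
      fun j => j.elim0, fun v => by simp, fun v => ?_⟩
    dsimp only
    rw [pderiv_iterPderiv]
    refine (card_support_iterPderiv_le _ _).trans (le_trans ?_ (hbig v))
    exact (card_support_eval_add_le_size_of_depth_le_three as hdepth).trans hsize
  | powProd ps =>
    -- Lemma 4.1 on the row's variable set `W = var(T) ∪ {x_v}`
    set W : Finset ι := T.support ∪ Finset.univ.image x with hW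
    obtain ⟨m, φ, e, hev, hoccv, hszv, hdpv, hPcard, hPout, hfac⟩ :=
      gcdTrick_powProd ps hocc W
    have hWcard : W.card ≤ c + ρ := card_support_union_image_le x hT
    -- the children are depth-`≤ 2`, hence `s`-sparse
    have hps_depth : ps.depth ≤ 2 := by
      have h := hdepth; rw [OccurFormula.depth] at h; omega
    have hφs : ∀ j, ((φ j).eval).support.card ≤ s := by
      intro j
      refine OccurFormula.card_support_eval_le_of_depth_le_two hs (φ j)
        ((hdpv j).trans hps_depth) ?_
      rw [OccurFormula.size] at hsize
      rw [hszv] at hsize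
      have : e j + (φ j).size ≤ ∑ i, (e i + (φ i).size) :=
        Finset.single_le_sum (f := fun i => e i + (φ i).size) (fun _ _ => Nat.zero_le _)
          (Finset.mem_univ j)
      omega
    -- kept children `P` (involving a variable of `W`): at most `k·|W| ≤ k(c+ρ) ≤ q₀`
    set P : Finset (Fin m) := Finset.univ.filter fun j => ∃ i ∈ W, i ∈ (φ j).eval.vars with hP
    have hPq : P.card ≤ q₀ := hPcard.trans ((Nat.mul_le_mul_left k hWcard).trans hq₀)
    -- the second factoring, entry by entry
    have hrow : ∀ v : Fin ρ, ∃ Q : MvPolynomial ι F,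
        iterPderiv (A := F) (Finsupp.single (x v) 1 + T) (∏ j ∈ P, (φ j).eval ^ e j) =
          (∏ j ∈ P, (φ j).eval ^ (e j - (c + 1))) * Q ∧
        Q.support.card ≤ (q₀ + 1) ^ (c + 1) * s ^ (2 * q₀ * (c + 1)) := fun v =>
      exists_iterPderiv_prod_pow_eq_mul (fun j => (φ j).eval) e hs hφs P hPq _
        (by rw [degree_single_add]; omega)
    choose Q hQ hQc using hrow
    -- exponents of the common row factor: `e_j` off `P`, `e_j ∸ (c+1)` on `P`
    refine ⟨m, fun j => (φ j).eval, fun j => if j ∈ P then e j - (c + 1) else e j, Q, hφs,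
      fun v => ?_, hQc⟩
    have hβ : (Finsupp.single (x v) 1 + T).support ⊆ W := support_single_add_subset x T v
    rw [pderiv_iterPderiv, OccurFormula.eval, hfac _ hβ, hQ v, ← mul_assoc]
    congr 1
    rw [← Finset.prod_filter_mul_prod_filter_not Finset.univ (fun j => j ∈ P), mul_comm]
    congr 1
    · refine Finset.prod_congr ?_ fun j hj => ?_
      · ext j; simp [hP]
      · dsimp only
        rw [if_pos (Finset.mem_filter.1 hj).2]
    · refine Finset.prod_congr ?_ fun j hj => ?_
      · ext j; simp [hP]
      · dsimp only
        rw [if_neg (Finset.mem_filter.1 hj).2]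

/-! ### `Φ` keeps the depth-3 minors non-zero -/

variable {n : ℕ}

/-- **The sparse-hitting `Φ` keeps every non-zero Jacobian minor of a depth-3 derivative family
non-zero** once it hits sparsity `≤ r!·((k(c+r)+1)^{c+1}·s^{2k(c+r)(c+1)})^r` (`ρ ≤ r` rows): the
minor is `∏_u (row factor)_u · det(row_{u,v})`, the row factors are powers of NON-ZERO `s`-sparse
polynomials (hit by `Φ` one by one, product in a domain) and `det(row)` has at most `ρ!·S₀^ρ`
monomials ("any `|𝒰'| × |𝒰'|` minor … is a sparse polynomial … one of the maps `Φ_p` … preserves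
the rank"). [cite: AgrawalEtAl2011, §4 (Thm. dDkrPIT, proof, bottom level) with Lemma 4.1; ForbesShpilkaVolk2018, Thm. 48 (seq.) = ToC Thm. 5.24 (the map `Φ`)]
locator: paper:arxiv-1111.0582 p0010.txt:L52–L60 -/
theorem bind₁_det_jacobian_depthThree_ne_zero {τ : Type*} {m k s c ρ r B : ℕ}
    (hk : 1 ≤ k) (hs : 1 ≤ s)
    (G : Fin m → OccurFormula F (multilinearMonomials n)) (T : Fin m → multilinearMonomials n →₀ ℕ)
    (hocc : ∀ u i, (G u).occur i ≤ k) (hsize : ∀ u, (G u).size ≤ s)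
    (hdepth : ∀ u, (G u).depth ≤ 3) (hT : ∀ u, (T u).degree ≤ c) (hρr : ρ ≤ r)
    (hB : r.factorial * ((k * (c + r) + 1) ^ (c + 1) * s ^ (2 * (k * (c + r)) * (c + 1))) ^ r ≤ B)
    (Φ : multilinearMonomials n → MvPolynomial τ F)
    (hΦ : IsHittingSetGenerator
      {P : MvPolynomial (multilinearMonomials n) F | P.support.card ≤ B} Φ)
    (rows : Fin ρ → Fin m) (cols : Fin ρ → multilinearMonomials n)
    (hdet : (Matrix.of fun u v =>
      pderiv (cols v) (iterPderiv (A := F) (T (rows u)) (G (rows u)).eval)).det ≠ 0) :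
    MvPolynomial.bind₁ Φ (Matrix.of fun u v =>
      pderiv (cols v) (iterPderiv (A := F) (T (rows u)) (G (rows u)).eval)).det ≠ 0 := by
  classical
  set q₀ : ℕ := k * (c + r) with hq₀
  set S₀ : ℕ := (q₀ + 1) ^ (c + 1) * s ^ (2 * q₀ * (c + 1)) with hS₀
  -- factor every row
  have hrow := fun u : Fin ρ => exists_rowFactor_depthThree (q₀ := q₀) hk hs (G (rows u))
    (hocc (rows u)) (hsize (rows u)) (hdepth (rows u)) (T (rows u)) (hT (rows u)) cols
    (by rw [hq₀]; exact Nat.mul_le_mul_left k (Nat.add_le_add_left hρr c))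
  choose ν qf a row hqf hfac hrowc using hrow
  set Rf : Fin ρ → MvPolynomial (multilinearMonomials n) F := fun u => ∏ j, qf u j ^ a u j with hRf
  set N : Matrix (Fin ρ) (Fin ρ) (MvPolynomial (multilinearMonomials n) F) :=
    Matrix.of fun u v => row u v with hN
  have hM : (Matrix.of fun u v =>
      pderiv (cols v) (iterPderiv (A := F) (T (rows u)) (G (rows u)).eval)) =
      Matrix.of fun u v => Rf u * N u v := by
    refine Matrix.ext fun u v => ?_
    simp only [Matrix.of_apply, hN, hRf]
    exact hfac u v
  rw [hM, Matrix.det_mul_column] at hdet ⊢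
  rw [map_mul]
  have hRf0 : (∏ u, Rf u) ≠ 0 := left_ne_zero_of_mul hdet
  have hN0 : N.det ≠ 0 := right_ne_zero_of_mul hdet
  refine mul_ne_zero ?_ ?_
  · -- the row factors: powers of non-zero `s`-sparse polynomials
    rw [map_prod]
    refine Finset.prod_ne_zero_iff.2 fun u _ => ?_
    have hRfu : Rf u ≠ 0 := fun h0 =>
      hRf0 (Finset.prod_eq_zero (Finset.mem_univ u) h0)
    -- with a row at hand, `ρ ≥ 1`, so `s ≤ B`
    have hsB : s ≤ B := by
      have hr1 : 1 ≤ r := le_trans (Nat.one_le_iff_ne_zero.mpr fun h => by subst h; exact u.elim0) hρr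
      have hq1 : 1 ≤ q₀ := by rw [hq₀]; nlinarith
      refine le_trans ?_ hB
      calc s = 1 * (1 * s ^ 1) ^ 1 := by ring
        _ ≤ r.factorial * ((k * (c + r) + 1) ^ (c + 1) * s ^ (2 * (k * (c + r)) * (c + 1))) ^ r := by
          refine Nat.mul_le_mul (Nat.one_le_iff_ne_zero.mpr (Nat.factorial_ne_zero r)) ?_
          refine (Nat.pow_le_pow_left (Nat.mul_le_mul (Nat.one_le_pow _ _ (Nat.succ_pos _))
            (Nat.pow_le_pow_right hs ?_)) 1).trans (Nat.pow_le_pow_right ?_ hr1)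
          · rw [← hq₀]; nlinarith
          · exact Nat.mul_pos (Nat.pow_pos (Nat.succ_pos _)) (Nat.pow_pos hs)
    rw [hRf]
    simp only [map_prod, map_pow]
    refine Finset.prod_ne_zero_iff.2 fun j _ => ?_
    rcases Nat.eq_zero_or_pos (a u j) with h0 | hpos
    · rw [h0, pow_zero]; exact one_ne_zero
    refine pow_ne_zero _ (hΦ _ ((hqf u j).trans hsB) fun hq0 => hRfu ?_)
    rw [hRf]
    exact Finset.prod_eq_zero (Finset.mem_univ j) (by rw [hq0, zero_pow hpos.ne'])
  · -- the residual determinant: sparse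
    refine hΦ _ (le_trans ?_ hB) hN0
    have hS1 : 1 ≤ S₀ := Nat.mul_pos (Nat.pow_pos (Nat.succ_pos _)) (Nat.pow_pos hs)
    calc N.det.support.card ≤ ρ.factorial * S₀ ^ ρ :=
          mvPolynomial_card_support_det_le N fun u v => by
            rw [hN, Matrix.of_apply, hS₀]; exact hrowc u v
      _ ≤ r.factorial * S₀ ^ r := Nat.mul_le_mul (Nat.factorial_le hρr) (Nat.pow_le_pow_right hS1 hρr)
      _ = r.factorial * ((k * (c + r) + 1) ^ (c + 1) * s ^ (2 * (k * (c + r)) * (c + 1))) ^ r := by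
          rw [hS₀, hq₀]

/-! ### The base case of the level induction, at depth 3 -/

/-- **[ASSS16] §4, base of the recursion at the level of the gates over the sparse leaves, in
Thm. 2.1 form.** Let `U_u = Δ_{T_u} G_u` (`u < m`, `m ≤ r`) be derivatives of orders `≤ c` of
sub-formulas `G_u` of depth `≤ 3` (leaves, `+`/`×∧` gates over leaves and constant gates) of
occur-`k` formulas (occur `≤ k`, `k ≥ 1`; size `≤ s`, `s ≥ 1`) in the `2^n` coefficient variables, and
assume `char(𝔽) = 0` or `char(𝔽) > ((s+1)^3)^r`. If `Φ` is a hitting-set generator for the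
polynomials with at most `B ≥ r!·((k(c+r)+1)^{c+1} s^{2k(c+r)(c+1)})^r` monomials and
`emb : Fin r ⊕ Unit ↪ σ` is a Vandermonde block apart from the (renamed) variables of `Φ`, then for
every `C`: `C(U) ≠ 0 ↔ C((x_m ↦ Vdm_r(m) + Φ(m)) ∘ U) ≠ 0` — "`Ψ_{D-2}` is faithful to `𝒞_{D-2}`",
one level above the tree's `ASSS16.baseLevel`. Proof as printed: a transcendence basis has a
non-zero Jacobian minor (Fact 1, `exists_trdeg_jacobianMinor_ne_zero`), which `Φ` keeps non-zero
(`bind₁_det_jacobian_depthThree_ne_zero`: gcd trick + sparsity), and Lemma 2.2 / Cor. 4.3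
(`descentFaithful`) lifts. [cite: AgrawalEtAl2011, §4 (Thm. dDkrPIT, proof, bottom level) with Lemma 4.1, Lemma 2.2 / Cor. 4.3]
locator: paper:arxiv-1111.0582 p0010.txt:L44–L58 -/
theorem baseLevelDepthThree {m r c k s B : ℕ} {σ τ : Type*}
    (G : Fin m → OccurFormula F (multilinearMonomials n)) (T : Fin m → multilinearMonomials n →₀ ℕ)
    (hk : 1 ≤ k) (hs : 1 ≤ s) (hocc : ∀ u i, (G u).occur i ≤ k) (hsize : ∀ u, (G u).size ≤ s)
    (hdepth : ∀ u, (G u).depth ≤ 3) (hT : ∀ u, (T u).degree ≤ c) (hm : m ≤ r)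
    (hchar : ringChar F = 0 ∨ ((s + 1) ^ 3) ^ r < ringChar F)
    (hB : r.factorial * ((k * (c + r) + 1) ^ (c + 1) * s ^ (2 * (k * (c + r)) * (c + 1))) ^ r ≤ B)
    (Φ : multilinearMonomials n → MvPolynomial τ F)
    (hΦ : IsHittingSetGenerator
      {P : MvPolynomial (multilinearMonomials n) F | P.support.card ≤ B} Φ)
    (ι' : τ → σ) (hι' : Function.Injective ι')
    (emb : Fin r ⊕ Unit → σ) (hemb : Function.Injective emb) (hdisj : ∀ v w, emb v ≠ ι' w)
    (C : MvPolynomial (Fin m) F) :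
    aeval (fun u => iterPderiv (A := F) (T u) (G u).eval) C ≠ 0 ↔
      aeval (fun u => aeval (fun mm : multilinearMonomials n =>
        rename emb (vdmGenCoeff F n r (mm : Fin n →₀ ℕ)) + rename ι' (Φ mm))
          (iterPderiv (A := F) (T u) (G u).eval)) C ≠ 0 := by
  classical
  haveI : Fintype (multilinearMonomials n) := Fintype.ofEquiv (Fin (2 ^ n)) (binaryOrder n)
  set U : Fin m → MvPolynomial (multilinearMonomials n) F :=
    fun u => iterPderiv (A := F) (T u) (G u).eval with hU
  have hdegU : ∀ u, (U u).totalDegree ≤ (s + 1) ^ 3 := fun u =>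
    OccurFormula.totalDegree_iterPderiv_eval_le (G u) (hsize u) (hdepth u) (T u)
  have htr : TrdegLE F U r := trdegLE_fin_of_le U hm
  -- the next-level map `Ψ = rename ι' ∘ Φ` as an algebra map, and its left inverse `killCompl`
  let Ψ : MvPolynomial (multilinearMonomials n) F →ₐ[F] MvPolynomial σ F :=
    aeval fun mm => rename ι' (Φ mm)
  have hΨX : ∀ mm, Ψ (X mm) = rename ι' (Φ mm) := fun mm => by simp only [Ψ, aeval_X]
  have hS : ∀ mm, killCompl hι' (Ψ (X mm)) = Φ mm := fun mm => by
    rw [hΨX, killCompl_rename_app]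
  have hfresh : ∀ mm : multilinearMonomials n, ∀ v ∈ (Ψ (X mm)).vars, v ∉ Set.range emb := by
    intro mm v hv ⟨u, hu⟩
    rw [hΨX] at hv
    obtain ⟨w, -, rfl⟩ := Finset.mem_image.mp (vars_rename ι' (Φ mm) hv)
    exact hdisj u w hu
  -- (S0) a non-zero maximal Jacobian minor of `U`
  obtain ⟨ρ, hρr, hρ, rows, cols, -, -, hdet⟩ :=
    exists_trdeg_jacobianMinor_ne_zero U hdegU htr hchar
  -- `Φ` — hence `Ψ` — keeps it non-zero
  have hΦdet : MvPolynomial.bind₁ Φ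
      (Matrix.of fun u v => pderiv (cols v) (U (rows u))).det ≠ 0 :=
    bind₁_det_jacobian_depthThree_ne_zero hk hs G T hocc hsize hdepth hT hρr hB Φ hΦ rows cols hdet
  have hΨdet : Ψ (Matrix.of fun u v => pderiv (cols v) (U (rows u))).det ≠ 0 := by
    have h1 : Ψ (Matrix.of fun u v => pderiv (cols v) (U (rows u))).det =
        MvPolynomial.bind₁ (fun mm => Ψ (X mm))
          (Matrix.of fun u v => pderiv (cols v) (U (rows u))).det := by
      rw [← MvPolynomial.aeval_eq_bind₁]
      exact congrArg (fun f : MvPolynomial (multilinearMonomials n) F →ₐ[F] MvPolynomial σ F =>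
        f (Matrix.of fun u v => pderiv (cols v) (U (rows u))).det) (MvPolynomial.aeval_unique Ψ)
    rw [h1]
    exact bind₁_ne_zero_of_algHom_comp_eq _ Φ (fun mm => Ψ (X mm)) (killCompl hι') hS hΦdet
  -- (S1) Lemma 2.2 / Cor. 4.3 in minor form, then unfold `Ψ (X mm)`
  have h := descentFaithful U hdegU htr hchar Ψ emb hemb hfresh hρ rows cols hΨdet C
  simp only [hΨX] at h
  exact h

end ASSS16

end Literature.Computability.AlgebraicComplexity
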